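import Literature.NumberTheory.EllipticCurves.NeronModelGroupStructure
import Literature.NumberTheory.EllipticCurves.NeronModelBaseChange
import HarnessLib

/-!
# The Néron mapping property is local on the base

Third infrastructure file of the existence programme for Néron models
(`Literature.NumberTheory.EllipticCurves.NeronModelExistence`; see `NeronModelBaseChange`,
`NeronModelGroupStructure`, `NeronModelGluing`). Main result
(`IsSchematicNeronModel.of_localization_away`): let `R` be a domain with fraction field `K` and
`Spec R = ⋃ᵢ D(aᵢ)` a cover by basic open sets (`aᵢ ≠ 0` generating the unit ideal). An `R`-scheme
`𝒩` whose restrictions `𝒩 ×_R R[1/aᵢ]` are Néron models of the `K`-scheme `E` over `R[1/aᵢ]` (in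
the group-free sense `IsSchematicNeronModel` of `NeronModelGroupStructure`; by
`IsSchematicNeronModel.exists_grp` this is no loss) is a Néron model of `E` over `R`. This is the
"local nature" of Néron models (Bosch–Lütkebohmert–Raynaud, *Néron Models*, §1.2, Prop. 4) in the
form used by the gluing arguments of BLR §1.4, Silverman (*ATAEC*, proof of Thm. IV.6.1, p. 340)
and Artin (*Néron Models*, proof of Thm. (1.2), p. 228); together with Mathlib's relative gluing
(`AlgebraicGeometry.Scheme.Cover.RelativeGluingData`, Stacks 01LH) it reduces the two-open-sets
gluing fact `exists_isNeronModel_of_away_of_away` of `NeronModelGluing` to the construction of the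
glued scheme.

## Contents

* `bijective_map_pullback_iff`, `bijective_map_iff_of_iso`, `bijective_map_of_fac`: the mapping
  property over an open part `S' ⊆ S` of the base in "`S`-form" — for smooth `S`-schemes whose
  structure map factors through `S'` — equivalent to the mapping property of `𝒩 ×_S S'` over `S'`
  (conjugation by the adjunction `Over.map ⊣ Over.pullback` and the isomorphisms of
  `NeronModelBaseChange`).
* `isIso_pullback_map_counit_app`, `isIso_pullback_map_counit`: `(𝒳 ×_S S')_T ≅ 𝒳_T` when
  `T → S` factors through the monomorphism `S' → S`.
* `IsSchematicNeronModel.of_localization_away`: the theorem above. The proof glues morphisms,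
  never schemes: injectivity by `Scheme.Cover.hom_ext` on the cover `{𝒳 ×_R R[1/aᵢ]}` of a smooth
  `𝒳`, surjectivity by `Scheme.Cover.glueMorphisms`, the overlap compatibility being again an
  instance of injectivity (over the chart `D(aᵢ)` through which the overlap maps).

## References

* S. Bosch, W. Lütkebohmert, M. Raynaud, *Néron Models*, Springer 1990, §1.2 (Prop. 4), §1.4.
  [BLRNeronModels1990]
* J. H. Silverman, *Advanced Topics in the Arithmetic of Elliptic Curves*, GTM 151, 1994, proof of
  Thm. IV.6.1, p. 340. [SilvermanATAEC1994]
* M. Artin, *Néron Models*, in Cornell–Silverman, *Arithmetic Geometry*, 1986, proof of Thm. (1.2),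
  p. 228. [Artin1986NeronModels]
* The Stacks project, Tag 01LH (relative gluing). [StacksProject]
-/

noncomputable section

universe u

namespace Literature.NumberTheory.EllipticCurves

open AlgebraicGeometry CategoryTheory
open scoped CategoryTheory.Obj

section SForm

variable {S S' T : Scheme.{u}} (φ : S' ⟶ S) [Mono φ] (a' : T ⟶ S')

/-- `bijective_map_pullback` (of `NeronModelBaseChange`) as an equivalence: for a monomorphism
`φ : S' ⟶ S`, bijectivity of base change to `T` (along `a' ≫ φ`) on `Hom_S(𝒳' → S' → S, 𝒩)` is
equivalent to bijectivity of base change to `T` (along `a'`) on `Hom_{S'}(𝒳', 𝒩 ×_S S')`: the two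
maps are conjugate under the adjunction bijection and composition with isomorphisms
(`map_homEquiv_eq`). [folklore] -/
theorem bijective_map_pullback_iff (𝒩 : Over S) (𝒳' : Over S') :
    (Function.Bijective fun f : (Over.map φ).obj 𝒳' ⟶ 𝒩 => (Over.pullback (a' ≫ φ)).map f) ↔
      Function.Bijective
        fun f' : 𝒳' ⟶ (Over.pullback φ).obj 𝒩 => (Over.pullback a').map f' := by
  have hfun : (fun f' : 𝒳' ⟶ (Over.pullback φ).obj 𝒩 => (Over.pullback a').map f') =
      (fun g => (pullbackMapIso φ a' 𝒳').hom ≫ g ≫ (pullbackPullbackIso φ a' 𝒩).inv) ∘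
        (fun f : (Over.map φ).obj 𝒳' ⟶ 𝒩 => (Over.pullback (a' ≫ φ)).map f) ∘
          ((Over.mapPullbackAdj φ).homEquiv 𝒳' 𝒩).symm := by
    funext f'
    obtain ⟨f, rfl⟩ := ((Over.mapPullbackAdj φ).homEquiv 𝒳' 𝒩).surjective f'
    simp only [Function.comp_apply, Equiv.symm_apply_apply]
    exact map_homEquiv_eq φ a' 𝒳' 𝒩 f
  have hconj :=
    (Iso.homCongr (pullbackMapIso φ a' 𝒳').symm (pullbackPullbackIso φ a' 𝒩).symm).bijective
  rw [hfun]
  constructor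
  · intro H
    exact hconj.comp (H.comp (Equiv.bijective _))
  · intro H
    have H' := (Function.Bijective.of_comp_iff' hconj _).mp H
    exact (Function.Bijective.of_comp_iff _ (Equiv.bijective _)).mp H'

omit [Mono φ] in
/-- Bijectivity of `f ↦ (base change of f along a)` on `Hom_S(𝒴, 𝒩)` is invariant under
isomorphisms of the source `𝒴`. [folklore] -/
theorem bijective_map_iff_of_iso {T : Scheme.{u}} (a : T ⟶ S) (𝒩 : Over S) {𝒴₁ 𝒴₂ : Over S}
    (e : 𝒴₁ ≅ 𝒴₂) :
    (Function.Bijective fun f : 𝒴₁ ⟶ 𝒩 => (Over.pullback a).map f) ↔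
      Function.Bijective fun f : 𝒴₂ ⟶ 𝒩 => (Over.pullback a).map f := by
  have hfun : (fun f : 𝒴₁ ⟶ 𝒩 => (Over.pullback a).map f) =
      (Iso.homCongr ((Over.pullback a).mapIso e).symm (Iso.refl _)) ∘
        (fun f : 𝒴₂ ⟶ 𝒩 => (Over.pullback a).map f) ∘ (Iso.homCongr e (Iso.refl _)) := by
    funext f
    simp [Iso.homCongr_apply, ← Functor.map_comp]
  rw [hfun, Function.Bijective.of_comp_iff' (Equiv.bijective _),
    Function.Bijective.of_comp_iff _ (Equiv.bijective _)]

variable [IsOpenImmersion φ]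

omit [Mono φ] in
/-- **The mapping property over an open part of the base, in `S`-form.** Let `φ : S' ⟶ S` be an
open immersion and `a = a' ≫ φ`. If `𝒩 ×_S S'` has the Néron mapping property over `S'` (base
change along `a'` is bijective on `Hom_{S'}(𝒴', 𝒩 ×_S S')` for every smooth `S'`-scheme `𝒴'`),
then base change along `a` is bijective on `Hom_S(𝒴, 𝒩)` for every smooth `S`-scheme `𝒴` whose
structure morphism factors through `φ` (such a `𝒴` is `𝒴' → S' → S` for the smooth `S'`-scheme
`𝒴' = (𝒴 → S')`, smooth by left cancellation of open immersions). [folklore] -/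
theorem bijective_map_of_fac {a : T ⟶ S} (ha : a' ≫ φ = a) (𝒩 : Over S)
    (H : ∀ 𝒴' : Over S', Smooth 𝒴'.hom →
      Function.Bijective fun f' : 𝒴' ⟶ (Over.pullback φ).obj 𝒩 => (Over.pullback a').map f')
    (𝒴 : Over S) (h𝒴 : Smooth 𝒴.hom) (q : 𝒴.left ⟶ S') (hq : q ≫ φ = 𝒴.hom) :
    Function.Bijective fun f : 𝒴 ⟶ 𝒩 => (Over.pullback a).map f := by
  subst ha
  have hq' : Smooth q :=
    MorphismProperty.of_postcomp (W := @Smooth) (W' := @IsOpenImmersion) q φ inferInstance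
      (by rw [hq]; exact h𝒴)
  let 𝒴' : Over S' := Over.mk q
  let e : 𝒴 ≅ (Over.map φ).obj 𝒴' := Over.isoMk (Iso.refl _) (by
    exact (Category.id_comp _).trans hq)
  rw [bijective_map_iff_of_iso (a' ≫ φ) 𝒩 e, bijective_map_pullback_iff]
  exact H 𝒴' hq'

omit [Mono φ] [IsOpenImmersion φ] in
/-- If `(𝒩 ×_S S') ×_{S'} T` is isomorphic to `E` over `T`, so is `𝒩 ×_S T` for `a = a' ≫ φ`
(transitivity of base change, `pullbackPullbackIso`). [folklore] -/
theorem nonempty_iso_of_pullback_pullback {a : T ⟶ S} (ha : a' ≫ φ = a) (𝒩 : Over S) (E : Over T)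
    (H : Nonempty ((Over.pullback a').obj ((Over.pullback φ).obj 𝒩) ≅ E)) :
    Nonempty ((Over.pullback a).obj 𝒩 ≅ E) := by
  subst ha
  exact ⟨(pullbackPullbackIso φ a' 𝒩).symm ≪≫ H.some⟩

omit [IsOpenImmersion φ] in
/-- For a monomorphism `φ : S' ⟶ S`, the base change along `φ` of the counit
`(𝒳 ×_S S' → S' → S) ⟶ 𝒳` of `Over.map φ ⊣ Over.pullback φ` is an isomorphism (by the triangle
identity it is inverse to the unit, which is invertible, `isIso_mapPullbackAdj_unit_app`).
[folklore] -/
theorem isIso_pullback_map_counit_app (𝒳 : Over S) :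
    IsIso ((Over.pullback φ).map ((Over.mapPullbackAdj φ).counit.app 𝒳)) := by
  have h := (Over.mapPullbackAdj φ).right_triangle_components 𝒳
  have hf := isIso_mapPullbackAdj_unit_app φ ((Over.pullback φ).obj 𝒳)
  have hfg : IsIso (((Over.mapPullbackAdj φ).unit.app ((Over.pullback φ).obj 𝒳) :
      (Over.pullback φ).obj 𝒳 ⟶
        (Over.pullback φ).obj ((Over.map φ).obj ((Over.pullback φ).obj 𝒳))) ≫
      (Over.pullback φ).map ((Over.mapPullbackAdj φ).counit.app 𝒳)) :=
    ⟨⟨𝟙 _, (Category.comp_id _).trans h, (Category.id_comp _).trans h⟩⟩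
  exact @IsIso.of_isIso_comp_left _ _ _ _ _ _ _ hf hfg

omit [IsOpenImmersion φ] in
/-- For a monomorphism `φ : S' ⟶ S` through which `a = a' ≫ φ : T ⟶ S` factors, the counit
`(𝒳 ×_S S' → S' → S) ⟶ 𝒳` becomes an isomorphism after base change along `a`: up to the
transitivity isomorphisms it is the base change along `a'` of the isomorphism
`isIso_pullback_map_counit_app`. [folklore] -/
theorem isIso_pullback_map_counit {a : T ⟶ S} (ha : a' ≫ φ = a) (𝒳 : Over S) :
    IsIso ((Over.pullback a).map ((Over.mapPullbackAdj φ).counit.app 𝒳)) := by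
  subst ha
  haveI := isIso_pullback_map_counit_app φ 𝒳
  have key := pullbackPullbackIso_naturality φ a' ((Over.mapPullbackAdj φ).counit.app 𝒳)
  -- key : (pullback a').map ((pullback φ).map c) ≫ (ppIso 𝒳).hom
  --         = (ppIso _).hom ≫ (pullback (a' ≫ φ)).map c
  haveI : IsIso ((pullbackPullbackIso φ a' _).hom ≫
      (Over.pullback (a' ≫ φ)).map ((Over.mapPullbackAdj φ).counit.app 𝒳)) := by
    rw [← key]
    infer_instance
  exact IsIso.of_isIso_comp_left (pullbackPullbackIso φ a' _).hom _

end SForm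

section Local

variable {R : Type u} [CommRing R] {K : Type u} [Field K] [Algebra R K] [IsFractionRing R K]
  {𝒩 : Over (Spec (.of R))} {E : Over (Spec (.of K))}

/-- **The Néron mapping property is local on the base** (Bosch–Lütkebohmert–Raynaud, *Néron
Models*, §1.2, Prop. 4 (local nature of Néron models); the gluing step in Silverman, *ATAEC*,
proof of Thm. IV.6.1, p. 340, and in Artin, *Néron Models*, proof of Thm. (1.2), p. 228). Let `R`
be a domain with fraction field `K`, `a : ι → R` non-zero elements generating the unit ideal
(so `Spec R = ⋃ D(aᵢ)`), `𝒩` an `R`-scheme and `E` a `K`-scheme. If for every `i` and every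
`R`-algebra model `R'` of `R[1/aᵢ]` (mapping compatibly to `K`) the base change `𝒩 ×_R R'` is a
Néron model of `E` over `R'` in the group-free sense `IsSchematicNeronModel`, then `𝒩` is a Néron
model of `E` over `R`. Proof: smoothness, separatedness and finite type are local on the target
(Mathlib `IsZariskiLocalAtTarget`); `𝒩_K ≅ (𝒩 ×_R R[1/aᵢ₀])_K ≅ E`; for the mapping property,
with charts `𝒳ᵢ = 𝒳 ×_R R[1/aᵢ] → 𝒳` of a smooth `R`-scheme `𝒳` (an open cover): two morphisms
`𝒳 → 𝒩` with the same generic fibre agree on each chart by the `S`-form of the mapping property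
over `D(aᵢ)` (`bijective_map_of_fac`), hence agree (`Scheme.Cover.hom_ext`); a morphism
`u : 𝒳_K → 𝒩_K` extends over each chart to `gᵢ : 𝒳ᵢ → 𝒩` with generic fibre `(𝒳ᵢ)_K → 𝒳_K → 𝒩_K`,
the `gᵢ` agree on overlaps `𝒳ᵢ ∩ 𝒳ⱼ` (again by the `S`-form injectivity over `D(aᵢ)`, the overlap
mapping to `D(aᵢ)`), glue (`Scheme.Cover.glueMorphisms`) to `g : 𝒳 → 𝒩`, and `g_K = u` because
`(𝒳ᵢ₀)_K → 𝒳_K` is an isomorphism (`isIso_pullback_map_counit`).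
[cite: SilvermanATAEC1994, proof of Thm. IV.6.1 (p. 340)] -/
theorem IsSchematicNeronModel.of_localization_away {ι : Type*} (a : ι → R)
    (hspan : Ideal.span (Set.range a) = ⊤) (ha : ∀ i, a i ≠ 0)
    (H : ∀ (i : ι) (R' : Type u) [CommRing R'] [Algebra R R'] [IsLocalization.Away (a i) R']
      [Algebra R' K] [IsScalarTower R R' K],
      IsSchematicNeronModel R' K ((Over.pullback (specOfAlgebraMap R R')).obj 𝒩) E) :
    IsSchematicNeronModel R K 𝒩 E := by
  have hunit : ∀ i, IsUnit (algebraMap R K (a i)) := fun i =>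
    isUnit_iff_ne_zero.mpr ((map_ne_zero_iff _ (IsFractionRing.injective R K)).mpr (ha i))
  letI : ∀ i, Algebra (Localization.Away (a i)) K := fun i =>
    (IsLocalization.Away.lift (a i) (hunit i)).toAlgebra
  haveI : ∀ i, IsScalarTower R (Localization.Away (a i)) K := fun i =>
    IsScalarTower.of_algebraMap_eq fun x => (IsLocalization.Away.lift_eq (a i) (hunit i) x).symm
  have Hi := fun i => H i (Localization.Away (a i))
  -- notation: the charts of the base and the factorisation of the generic point through them
  let φ : ∀ i, Spec (.of (Localization.Away (a i))) ⟶ Spec (.of R) := fun i =>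
    specOfAlgebraMap R (Localization.Away (a i))
  have hφ : ∀ i, specGenericPoint (Localization.Away (a i)) K ≫ φ i = specGenericPoint R K :=
    fun i => specGenericPoint_comp_specOfAlgebraMap R K _
  let 𝒰 : (Spec (CommRingCat.of R)).OpenCover :=
    (Scheme.affineOpenCoverOfSpanRangeEqTop (R := .of R) a hspan).openCover
  -- the mapping property of `𝒩` for smooth `R`-schemes over a chart (`S`-form)
  have MP : ∀ (i : ι) (𝒴 : Over (Spec (.of R))), Smooth 𝒴.hom → ∀ q : 𝒴.left ⟶ _, q ≫ φ i = 𝒴.hom →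
      Function.Bijective fun f : 𝒴 ⟶ 𝒩 => (genericFibre R K).map f := fun i 𝒴 h𝒴 q hq =>
    bijective_map_of_fac (φ i) (specGenericPoint _ K) (hφ i) 𝒩 (Hi i).mappingProperty 𝒴 h𝒴 q hq
  haveI : Nontrivial R := (algebraMap R K).domain_nontrivial
  haveI hne : Nonempty ι := by
    by_contra hι
    rw [not_nonempty_iff] at hι
    have : (Ideal.span (Set.range a) : Ideal R) = ⊥ := by simp [Set.range_eq_empty]
    rw [hspan] at this
    exact top_ne_bot this
  obtain ⟨i₀⟩ := hne
  refine
    { smooth := ?_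
      isSeparated := ?_
      locallyOfFiniteType := ?_
      quasiCompact := ?_
      nonempty_iso := nonempty_iso_of_pullback_pullback (φ i₀) _ (hφ i₀) 𝒩 E (Hi i₀).nonempty_iso
      mappingProperty := ?_ }
  · rw [IsZariskiLocalAtTarget.iff_of_openCover (P := @Smooth) 𝒰]
    exact fun i => (Hi i).smooth
  · rw [IsZariskiLocalAtTarget.iff_of_openCover (P := @IsSeparated) 𝒰]
    exact fun i => (Hi i).isSeparated
  · rw [IsZariskiLocalAtTarget.iff_of_openCover (P := @LocallyOfFiniteType) 𝒰]
    exact fun i => (Hi i).locallyOfFiniteType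
  · rw [IsZariskiLocalAtTarget.iff_of_openCover (P := @QuasiCompact) 𝒰]
    exact fun i => (Hi i).quasiCompact
  · intro 𝒳 h𝒳
    -- the charts `𝒳ᵢ = 𝒳 ×_R R[1/aᵢ]`, as `R`-schemes, with `cᵢ : 𝒳ᵢ ⟶ 𝒳`
    let 𝒳c : ι → Over (Spec (.of R)) := fun i => (Over.map (φ i)).obj ((Over.pullback (φ i)).obj 𝒳)
    let c : ∀ i, 𝒳c i ⟶ 𝒳 := fun i => (Over.mapPullbackAdj (φ i)).counit.app 𝒳
    have hc : ∀ i, (c i).left = Limits.pullback.fst 𝒳.hom (φ i) := fun i => by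
      simp [c, Over.mapPullbackAdj_counit_app]
    have h𝒳c : ∀ i, Smooth (𝒳c i).hom := fun i => by
      change Smooth (Limits.pullback.snd 𝒳.hom (φ i) ≫ φ i)
      exact MorphismProperty.comp_mem _ _ _ (MorphismProperty.pullback_snd _ _ h𝒳) inferInstance
    have hfac : ∀ i, ((Over.pullback (φ i)).obj 𝒳).hom ≫ φ i = (𝒳c i).hom := fun i => rfl
    -- the open cover of `𝒳` by the charts
    let 𝒱 : 𝒳.left.OpenCover := 𝒰.pullback₁ 𝒳.hom
    have h𝒱f : ∀ i : ι, 𝒱.f i = (c i).left := fun i => (hc i).symm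
    constructor
    · -- injectivity: two maps with the same generic fibre agree on each chart, hence everywhere
      intro f g hfg
      have hfg' : (genericFibre R K).map f = (genericFibre R K).map g := hfg
      ext : 1
      refine Scheme.Cover.hom_ext 𝒱 _ _ fun (i : ι) => ?_
      have key : c i ≫ f = c i ≫ g :=
        (MP i (𝒳c i) (h𝒳c i) _ (hfac i)).1 (by
          simp only [Functor.map_comp]
          rw [hfg'])
      rw [h𝒱f i]
      exact congrArg CommaMorphism.left key
    · -- surjectivity: extend over each chart, glue
      intro u
      choose g hg using fun i =>
        (MP i (𝒳c i) (h𝒳c i) _ (hfac i)).2 ((genericFibre R K).map (c i) ≫ u)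
      have hg' : ∀ i, (genericFibre R K).map (g i) = (genericFibre R K).map (c i) ≫ u := hg
      -- compatibility on overlaps
      have hcompat : ∀ i j : ι, Limits.pullback.fst (𝒱.f i) (𝒱.f j) ≫ (g i).left =
          Limits.pullback.snd (𝒱.f i) (𝒱.f j) ≫ (g j).left := by
        intro i j
        have hcond : Limits.pullback.fst (𝒱.f i) (𝒱.f j) ≫ (c i).left =
            Limits.pullback.snd (𝒱.f i) (𝒱.f j) ≫ (c j).left := by
          rw [← h𝒱f i, ← h𝒱f j]
          exact Limits.pullback.condition
        -- the overlap as an `R`-scheme through chart `i`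
        let W : Over (Spec (.of R)) :=
          Over.mk (Limits.pullback.fst (𝒱.f i) (𝒱.f j) ≫ (𝒳c i).hom)
        have hW : Smooth W.hom := by
          change Smooth (Limits.pullback.fst (𝒱.f i) (𝒱.f j) ≫ (𝒳c i).hom)
          refine MorphismProperty.comp_mem _ _ _ ?_ (h𝒳c i)
          have : IsOpenImmersion (𝒱.f j) := 𝒱.map_prop j
          infer_instance
        let p₁ : W ⟶ 𝒳c i := Over.homMk (Limits.pullback.fst (𝒱.f i) (𝒱.f j)) rfl
        have hp₂w : Limits.pullback.snd (𝒱.f i) (𝒱.f j) ≫ (𝒳c j).hom = W.hom := by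
          have e1 : (𝒳c j).hom = (c j).left ≫ 𝒳.hom := (Over.w (c j)).symm
          have e2 : (𝒳c i).hom = (c i).left ≫ 𝒳.hom := (Over.w (c i)).symm
          change _ = Limits.pullback.fst (𝒱.f i) (𝒱.f j) ≫ (𝒳c i).hom
          rw [e1, e2]
          exact ((reassoc_of% hcond) 𝒳.hom).symm
        let p₂ : W ⟶ 𝒳c j := Over.homMk (Limits.pullback.snd (𝒱.f i) (𝒱.f j)) hp₂w
        have hp : p₁ ≫ c i = p₂ ≫ c j := by
          ext : 1
          exact hcond
        have key : p₁ ≫ g i = p₂ ≫ g j :=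
          (MP i W hW (Limits.pullback.fst (𝒱.f i) (𝒱.f j) ≫ ((Over.pullback (φ i)).obj 𝒳).hom)
            (Category.assoc _ _ _)).1 (by
            simp only [Functor.map_comp, hg']
            rw [← Category.assoc, ← Category.assoc, ← Functor.map_comp, ← Functor.map_comp, hp])
        exact congrArg CommaMorphism.left key
      let gl : 𝒳.left ⟶ 𝒩.left := Scheme.Cover.glueMorphisms 𝒱 (fun i => (g i).left) hcompat
      have hgl : ∀ i : ι, (c i).left ≫ gl = (g i).left := fun i => by
        rw [← h𝒱f i]
        exact Scheme.Cover.ι_glueMorphisms 𝒱 _ hcompat i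
      have hover : gl ≫ 𝒩.hom = 𝒳.hom := by
        refine Scheme.Cover.hom_ext 𝒱 _ _ fun (i : ι) => ?_
        exact ((reassoc_of% (hgl i)) 𝒩.hom).trans ((Over.w (g i)).trans (Over.w (c i)).symm)
      refine ⟨Over.homMk gl hover, ?_⟩
      -- check on the chart `i₀`, where `cᵢ₀` becomes an isomorphism on generic fibres
      have hci₀ : c i₀ ≫ Over.homMk gl hover = g i₀ := by
        ext : 1
        exact hgl i₀
      haveI : IsIso ((genericFibre R K).map (c i₀)) :=
        isIso_pullback_map_counit (φ i₀) (specGenericPoint _ K) (hφ i₀) 𝒳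
      rw [← cancel_epi ((genericFibre R K).map (c i₀)), ← Functor.map_comp, hci₀, hg']

end Local


end Literature.NumberTheory.EllipticCurves

end
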